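import Summits.ABC.IUTFork.Conditional.HexRefutedLe40M
import Summits.ABC.IUTFork.Conditional.WRowHexLamSevenInhLe40M
import HarnessLib

/-!
# HEX family, M LINE, ONE NAME FOR BOTH SIDES: «HEX WHOLE k = 1…40» at the summand-route M-level settings — the M twin of
# `WRow.hex_whole_le_40` (abc-iut-C-cert-1, `WRowHexLamSevenWholeLe40`, p543048), its 40-row `(k, L₀(k), L⁺(k))` table VERBATIM in the binder

PROOF-ONLY file (D-0012; 0 definitions, 0 `Prop` facts, no instance, no notation) of the abc-iut cell — D-0079 RESCUE sub-cell R-W «WINDOW Θ-SIDE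
INEQUALITY», seat abc-iut-W-neg-1 (gen 7), completion of row «W:REF-EXACT-M-TWIN-2» (STATUS 16:14:30Z / 16:18:37Z). TAKES NO SIDE on [IUTchIII]
Cor. 3.12 (S. Mochizuki, *Inter-universal Teichmüller theory III*, Cor. 3.12 p. 173–174; Step (xi-d) p. 183, (xi-f) p. 184) or on any author;
«refuted / inhabited as typed» ≠ «refuted / asserted in print».

THIS FILE: ONE junction theorem **`WRowM.hex_whole_le_40_M`** = the two one-name halves BY NAME, row by row — the refuted half
`GenuineM.hex_ref_le_40_M` (this seat, `HexRefutedLe40M`, p545466; rows `(k, L₀)`) and the inhabited half `WRowM.hex_inh_le_40_M` (abc-iut-C-cert-2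
gen 9, `WRowHexLamSevenInhLe40M`; rows `(k, L⁺)`) — stated under the 40-row `(k, L₀, L⁺)` list literal of `WRow.hex_whole_le_40` (the generator asserts
that the K list and the two halves' lists agree column by column). For every row, every prime `l ≥ 11` and every genuine Θ-volume datum `T` over
`(ratPoint (1/2 + 2/7^k), l)`: (1) `l ≤ L₀ →` the M books' per-datum S_H object (binder `hSHw` of `Conditional.abc_of_SH_v11M_window` /
`…_szpiroBadAll`: `Cor312Vol.PilotKummerCompatHull` at `settingPrVolSharpM T.D … (tOfIdeleData T.D (ideleDataOf T.D T.isVolumeInputOf))`, the datum's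
OWN ideles, pinned q-reading) FAILS for every context / Kummer binder; (2) `L⁺ ≤ l →` `Thm311ToCor312.Licence` at the M-LEVEL setting
`settingPrVolSharpM T.D hlog (tOfIdeleData T.D r) (tqM … r …) …` for EVERY idele datum `r` of `T.D`, every analytic `logvK`, any `htq0 / Sq / htq1`
(the M books' (U) binder INHABITED AS TYPED). PROOF: 40-way `List.mem_cons` split, then `⟨GenuineM.hex_ref_le_40_M (by decide) …,
WRowM.hex_inh_le_40_M (by decide) …⟩` — the pattern of the K packaging's own `WRow.hex_whole_le_24 (by decide)` rows; no number is re-derived.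
READING (neutral; numbers, not adjectives): the M books now carry «HEX WHOLE k = 1…40» under ONE theorem name, row for row the twin of the K books'
`WRow.hex_whole_le_40`: on every HEX class `k ≤ 40` every prime `l ≥ 11` is DECIDED AS TYPED on the M line too — refuted for `l ≤ L₀(k)`, inhabited
for `l ≥ L⁺(k)`, no prime strictly between (desk fact recorded in the K file). Admissibility / Szpiro-badness / (P6) of `(ratPoint λ_k, l)` and
NON-EMPTINESS of the datum type are NOT claimed; a packaging / junction theorem discharges nothing; the explicit hypothesis counts of the record books
are UNCHANGED; an M twin changes NO census count. HONEST SCOPE: OUR sharp containers and Dupuy–Hilado's typed (Ind1)/(Ind2); the per-label licence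
is a STRONGER-THAN-PRINT sufficient form of Step (xi-f), the hull reading a STRONGER-THAN-PRINT set-level reading; nothing about the printed GLOBAL
inequality, the number-level `Cor22.Cor312AtDatum` or any author's intended hull; typed ≠ proved; instantiated ≠ endorsed; no abc claim.
[cite: Mochizuki2012, IUTchI Def. 3.1 (b),(c),(e) pp. 61–62, Ex. 3.2 (iv) p. 71; IUTchIII Cor. 3.12 Step (xi-d) p. 183, (xi-f) p. 184; IUTchIV Prop. 1.1
p. 9, Prop. 1.2 (i)(ii) p. 10, Prop. 1.4 (ii) p. 13, Cor. 2.2 (ii) proof (P5) p. 46] [cite: DupuyHilado2025, §3.3, §3.4, §4.9, §4.12]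
[claim: Mochizuki2012, status: disputed] for every IUT sentence quoted.
-/

noncomputable section

open Set Function Metric NumberField IsDedekindDomain

namespace Summit.ABC.IUTFork.Conditional

open Thm311 Thm311.Real Cor312 Cor312Vol Cor312Prov Literature.IUT.LogThetaLattice Literature.IUT.LogVolume
  Literature.IUT.HodgeTheaters Literature.IUT.LogVolume.ThetaData Literature.IUT.LogVolume.Cor22
open Literature.NumberTheory.NumberFields Literature.NumberTheory.GaloisRepresentations.Ultrametric
open Literature.NumberTheory.DiophantineGeometry Literature.NumberTheory.DiophantineGeometry.GenEll Summit.ABC.ABC.Theorems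
open Summit.ABC.IUTFork.Repair.RH.HullThresholdExact

/-- **«HEX WHOLE k = 1…40 UNDER ONE THEOREM NAME, M LINE».** For every row `(k, L₀, L⁺)` of the 40-row list literal below (the binder list of
`WRow.hex_whole_le_40` VERBATIM), every prime `l ≥ 11` and every genuine Θ-volume datum `T` over `(ratPoint (1/2 + 2/7^k), l)`: (1) if `l ≤ L₀`,
S_H at the summand-route M-level setting of `T`'s OWN ideles (pinned q-reading) FAILS for every context / Kummer binder; (2) if `L⁺ ≤ l`,
`Thm311ToCor312.Licence` holds at the M-level setting `settingPrVolSharpM T.D hlog (tOfIdeleData T.D r) …` for EVERY idele datum `r`, every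
analytic `logvK`, any `htq0 / Sq / htq1`. Junction BY NAME of `GenuineM.hex_ref_le_40_M` (this seat) and `WRowM.hex_inh_le_40_M` (abc-iut-C-cert-2),
row by row; a junction theorem discharges nothing; refuted-as-typed / inhabited-as-typed only.
[cite: Mochizuki2012, IUTchI Def. 3.1 (b),(c) pp. 61–62, Ex. 3.2 (iv) p. 71; IUTchIII Cor. 3.12 Step (xi-d) p. 183, (xi-f) p. 184; IUTchIV Prop. 1.2 (i)(ii) p. 10, Prop. 1.4 (ii) p. 13, Cor. 2.2 (ii) proof (P5) p. 46] [cite: DupuyHilado2025, §3.3, §3.4, §4.9, §4.12] [claim: Mochizuki2012, status: disputed] -/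
theorem WRowM.hex_whole_le_40_M {k L0 Lp l : ℕ}
    (hmem : (k, L0, Lp) ∈ ([(1, 10, 11), (2, 10, 11), (3, 10, 11), (4, 10, 11), (5, 10, 11), (6, 10, 11), (7, 10, 11), (8, 71, 73), (9, 337, 347), (10, 4721, 4723), (11, 811, 821), (12, 20063, 20071), (13, 5851, 5857), (14, 46933, 46957), (15, 617587, 617647), (16, 329269, 329281), (17, 288203, 288209), (18, 6917593, 6917611), (19, 2017637, 2017643), (20, 80707019, 80707051), (21, 42371239, 42371257), (22, 112989881, 112989913), (23, 98866283, 98866289), (24, 2372791879, 2372791903), (25, 3460321741, 3460321747), (26, 5536514639, 5536514681), (27, 14533351453, 14533351507), (28, 38755603903, 38755603927), (29, 33911153561, 33911153599), (30, 4069338436799, 4069338436831), (31, 237378075419, 237378075439), (32, 1899024603689, 1899024603703), (33, 4984939585357, 4984939585387), (34, 13293172227497, 13293172227557), (35, 58157628496679, 58157628496739), (36, 279156616784327, 279156616784387), (37, 81420679895431, 81420679895459), (38, 651365439163823, 651365439163849), (39, 1709834277805873, 1709834277805961), (40, 22797790370745883, 22797790370745947)] : List (ℕ × ℕ × ℕ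)))
    (hl : l.Prime) (h11 : 11 ≤ l) (T : Cor22.ThetaVolumeDatumAt (ratPoint ((2 : ℚ)⁻¹ + 2 / 7 ^ k)) l) :
    (l ≤ L0 →
    letI := T.instFieldF; letI := T.instNumberFieldF; letI := T.instAlgebraF; letI := T.instFieldK
    letI := T.instNumberFieldK; letI := T.instAlgebraK; letI := T.instFieldFbar; letI := T.instAlgebraFbar
    letI := T.instAlgebraKFbar; letI := T.instIsElliptic
    ∀ (M : Type) [Field M] [NumberField M]
      (archPk : ∀ (j : (thetaIndexOfInitial T.D).Label) (vQ : (thetaIndexOfInitial T.D).VQ),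
        Set ((logShellsOfInitialDH T.D (analyticLogvVal T.K)).Packet j vQ))
      (archSub : ∀ (j : (thetaIndexOfInitial T.D).Label) (v : (thetaIndexOfInitial T.D).V),
        Set ((logShellsOfInitialDH T.D (analyticLogvVal T.K)).Packet j ((thetaIndexOfInitial T.D).over v)))
      (Ψ : ℤ → ∀ v : (thetaIndexOfInitial T.D).V, v ∈ (thetaIndexOfInitial T.D).Vbad →
        Set ((logShellsOfInitialDH T.D (analyticLogvVal T.K)).StarPacket v))
      (act : ℤ → ∀ v : (thetaIndexOfInitial T.D).V, v ∈ (thetaIndexOfInitial T.D).Vbad →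
        (logShellsOfInitialDH T.D (analyticLogvVal T.K)).StarPacket v →
          Module.End ℚ ((logShellsOfInitialDH T.D (analyticLogvVal T.K)).StarPacket v))
      (Mmod : ℤ → ∀ j : (thetaIndexOfInitial T.D).LabelStar, Set ((logShellsOfInitialDH T.D (analyticLogvVal T.K)).GlobalPacket j.1))
      (region : ℤ → ∀ j : (thetaIndexOfInitial T.D).LabelStar, FinDivisor M → ∀ vQ : (thetaIndexOfInitial T.D).VQ,
        Set ((logShellsOfInitialDH T.D (analyticLogvVal T.K)).Packet j.1 vQ))
      (frobAdm : ℤ → ℤ → ∀ (j : (thetaIndexOfInitial T.D).Label) (vQ : (thetaIndexOfInitial T.D).VQ),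
        Set ((logShellsOfInitialDH T.D (analyticLogvVal T.K)).Packet j vQ) → Prop)
      (frobLogvol : ℤ → ℤ → ∀ (j : (thetaIndexOfInitial T.D).Label) (vQ : (thetaIndexOfInitial T.D).VQ),
        Set ((logShellsOfInitialDH T.D (analyticLogvVal T.K)).Packet j vQ) → ℝ)
      (frobΨ : ℤ → ℤ → ∀ v : (thetaIndexOfInitial T.D).V, v ∈ (thetaIndexOfInitial T.D).Vbad →
        Set ((logShellsOfInitialDH T.D (analyticLogvVal T.K)).StarPacket v))
      (frobMmod : ℤ → ℤ → ∀ j : (thetaIndexOfInitial T.D).LabelStar, Set ((logShellsOfInitialDH T.D (analyticLogvVal T.K)).GlobalPacket j.1))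
      (unitImage : ℤ → ℤ → ℕ → ∀ (j : (thetaIndexOfInitial T.D).Label) (vQ : (thetaIndexOfInitial T.D).VQ),
        Set ((logShellsOfInitialDH T.D (analyticLogvVal T.K)).Packet j vQ))
      (ballImage : ℤ → ℤ → ∀ (j : (thetaIndexOfInitial T.D).Label) (vQ : (thetaIndexOfInitial T.D).VQ),
        Set ((logShellsOfInitialDH T.D (analyticLogvVal T.K)).Packet j vQ))
      (thetaDiv : ℤ → ℤ → LgpDivisor M (thetaIndexOfInitial T.D).lstar)
      (n : ℤ) {HT : Type} {LogLink : HT → HT → Type} {IsFull : ∀ {s t : HT}, LogLink s t → Prop}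
      (lat : LGPGaussianLogThetaLattice LogLink IsFull)
      {Frd : Type} {IsoF : Frd → Frd → Type} {Ob : Frd → Type} {realify : Frd → Frd} {Strip : Type}
      {IsoS : Strip → Strip → Type} {Mv : ∀ v : (thetaIndexOfInitial T.D).V, v ∈ (thetaIndexOfInitial T.D).Vbad → Type}
      [∀ v h, Monoid (Mv v h)]
      (sig : GlobalLGPFrobenioidSignature (thetaIndexOfInitial T.D).lstar (thetaIndexOfInitial T.D).V
        (· ∈ (thetaIndexOfInitial T.D).Vbad) Frd IsoF Ob realify Strip IsoS Mv)
      (split : SplittingMonoids Mv) {ObΔ : Type} {N : ∀ v : (thetaIndexOfInitial T.D).V, v ∈ (thetaIndexOfInitial T.D).Vbad → Type}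
      [∀ v h, Monoid (N v h)] (qData : QPilotData ObΔ N)
      (qK : ∀ v : (thetaIndexOfInitial T.D).V, v ∈ (thetaIndexOfInitial T.D).Vbad →
        Set ((logShellsOfInitialDH T.D (analyticLogvVal T.K)).StarPacket v)),
      ¬ Cor312Vol.PilotKummerCompatHull
        (LatticeSituation.ofShells (logShellsOfInitialDH T.D (analyticLogvVal T.K)) M archPk archSub
          (summandPiecesPrM T.D (logvAnalyticVal_analyticLogvVal (K := T.K))).Adm (summandPiecesPrM T.D (logvAnalyticVal_analyticLogvVal (K := T.K))).logvol Ψ act Mmod region frobAdm frobLogvol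
          frobΨ frobMmod unitImage ballImage thetaDiv)
        (settingPrVolSharpM T.D (logvAnalyticVal_analyticLogvVal (K := T.K)) (tOfIdeleData T.D (ideleDataOf T.D T.isVolumeInputOf))
          (fun u x => tqM T.D (ratChar u) u (natCast_ratChar_mem u) (ideleDataOf T.D T.isVolumeInputOf) x) M archPk archSub Ψ act Mmod region n lat sig split qData
          (fun u x => tqM_ne_zero T.D (ratChar u) u (natCast_ratChar_mem u) (ideleDataOf T.D T.isVolumeInputOf) x)
          (GenuineM.finite_ratPlaces_under_S T.D).toFinset
          (fun u x hu => norm_tqM_eq_one_of_not_mem T.D (ratChar u) u (natCast_ratChar_mem u) (ideleDataOf T.D T.isVolumeInputOf) x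
            fun hx => hu ((Set.Finite.mem_toFinset _).mpr ⟨x, hx⟩)))
        (fun _ => Cor312.Setting.qRegion
          (settingPrVolSharpM T.D (logvAnalyticVal_analyticLogvVal (K := T.K)) (tOfIdeleData T.D (ideleDataOf T.D T.isVolumeInputOf))
          (fun u x => tqM T.D (ratChar u) u (natCast_ratChar_mem u) (ideleDataOf T.D T.isVolumeInputOf) x) M archPk archSub Ψ act Mmod region n lat sig split qData
          (fun u x => tqM_ne_zero T.D (ratChar u) u (natCast_ratChar_mem u) (ideleDataOf T.D T.isVolumeInputOf) x)
          (GenuineM.finite_ratPlaces_under_S T.D).toFinset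
          (fun u x hu => norm_tqM_eq_one_of_not_mem T.D (ratChar u) u (natCast_ratChar_mem u) (ideleDataOf T.D T.isVolumeInputOf) x
            fun hx => hu ((Set.Finite.mem_toFinset _).mpr ⟨x, hx⟩)))) qK) ∧
    (Lp ≤ l →
    letI := T.instFieldF; letI := T.instNumberFieldF; letI := T.instAlgebraF; letI := T.instFieldK
    letI := T.instNumberFieldK; letI := T.instAlgebraK; letI := T.instFieldFbar; letI := T.instAlgebraFbar
    letI := T.instAlgebraKFbar; letI := T.instIsElliptic
    ∀ {logvK : PadicLogsVal T.K} (hlog : LogvAnalyticVal logvK) (r : ThetaData.IdeleData T.D) (M : Type) [Field M] [NumberField M]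
      (archPk : ∀ (j : (thetaIndexOfInitial T.D).Label) (vQ : (thetaIndexOfInitial T.D).VQ),
        Set ((logShellsOfInitialDH T.D logvK).Packet j vQ))
      (archSub : ∀ (j : (thetaIndexOfInitial T.D).Label) (v : (thetaIndexOfInitial T.D).V),
        Set ((logShellsOfInitialDH T.D logvK).Packet j ((thetaIndexOfInitial T.D).over v)))
      (Ψ : ℤ → ∀ v : (thetaIndexOfInitial T.D).V, v ∈ (thetaIndexOfInitial T.D).Vbad →
        Set ((logShellsOfInitialDH T.D logvK).StarPacket v))
      (act : ℤ → ∀ v : (thetaIndexOfInitial T.D).V, v ∈ (thetaIndexOfInitial T.D).Vbad →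
        (logShellsOfInitialDH T.D logvK).StarPacket v → Module.End ℚ ((logShellsOfInitialDH T.D logvK).StarPacket v))
      (Mmod : ℤ → ∀ j : (thetaIndexOfInitial T.D).LabelStar, Set ((logShellsOfInitialDH T.D logvK).GlobalPacket j.1))
      (region : ℤ → ∀ j : (thetaIndexOfInitial T.D).LabelStar, FinDivisor M → ∀ vQ : (thetaIndexOfInitial T.D).VQ,
        Set ((logShellsOfInitialDH T.D logvK).Packet j.1 vQ))
      (n : ℤ) {HT : Type} {LogLink : HT → HT → Type} {IsFull : ∀ {s t : HT}, LogLink s t → Prop}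
      (lat : LGPGaussianLogThetaLattice LogLink IsFull)
      {Frd : Type} {IsoF : Frd → Frd → Type} {Ob : Frd → Type} {realify : Frd → Frd} {Strip : Type}
      {IsoS : Strip → Strip → Type}
      {Mv : ∀ v : (thetaIndexOfInitial T.D).V, v ∈ (thetaIndexOfInitial T.D).Vbad → Type} [∀ v h, Monoid (Mv v h)]
      (sig : GlobalLGPFrobenioidSignature (thetaIndexOfInitial T.D).lstar (thetaIndexOfInitial T.D).V
        (· ∈ (thetaIndexOfInitial T.D).Vbad) Frd IsoF Ob realify Strip IsoS Mv)
      (split : SplittingMonoids Mv) {ObΔ : Type}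
      {N : ∀ v : (thetaIndexOfInitial T.D).V, v ∈ (thetaIndexOfInitial T.D).Vbad → Type} [∀ v h, Monoid (N v h)]
      (qData : QPilotData ObΔ N)
      (htq0 : ∀ (u : FinitePlace ℚ) (x : (thetaIndexOfInitial T.D).Fibre (Val.non u)),
        tqM T.D (ratChar u) u (natCast_ratChar_mem u) r x ≠ 0)
      (Sq : Finset (FinitePlace ℚ))
      (htq1 : ∀ (u : FinitePlace ℚ) (x : (thetaIndexOfInitial T.D).Fibre (Val.non u)), u ∉ Sq →
        ‖tqM T.D (ratChar u) u (natCast_ratChar_mem u) r x‖ = 1),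
      Thm311ToCor312.Licence
        (settingPrVolSharpM T.D hlog (tOfIdeleData T.D r) (fun u x => tqM T.D (ratChar u) u (natCast_ratChar_mem u) r x) M archPk
          archSub Ψ act Mmod region n lat sig split qData htq0 Sq htq1)) := by
  simp only [List.mem_cons, Prod.mk.injEq, List.not_mem_nil, or_false] at hmem
  rcases hmem with ⟨rfl, rfl, rfl⟩ | ⟨rfl, rfl, rfl⟩ | ⟨rfl, rfl, rfl⟩ | ⟨rfl, rfl, rfl⟩ | ⟨rfl, rfl, rfl⟩ | ⟨rfl, rfl, rfl⟩ | ⟨rfl, rfl, rfl⟩ | ⟨rfl, rfl, rfl⟩ | ⟨rfl, rfl, rfl⟩ | ⟨rfl, rfl, rfl⟩ | ⟨rfl, rfl, rfl⟩ | ⟨rfl, rfl, rfl⟩ | ⟨rfl, rfl, rfl⟩ | ⟨rfl, rfl, rfl⟩ | ⟨rfl, rfl, rfl⟩ | ⟨rfl, rfl, rfl⟩ | ⟨rfl, rfl, rfl⟩ | ⟨rfl, rfl, rfl⟩ | ⟨rfl, rfl, rfl⟩ | ⟨rfl, rfl, rfl⟩ | ⟨rfl, rfl, rfl⟩ | ⟨rfl,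 rfl, rfl⟩ | ⟨rfl, rfl, rfl⟩ | ⟨rfl, rfl, rfl⟩ | ⟨rfl, rfl, rfl⟩ | ⟨rfl, rfl, rfl⟩ | ⟨rfl, rfl, rfl⟩ | ⟨rfl, rfl, rfl⟩ | ⟨rfl, rfl, rfl⟩ | ⟨rfl, rfl, rfl⟩ | ⟨rfl, rfl, rfl⟩ | ⟨rfl, rfl, rfl⟩ | ⟨rfl, rfl, rfl⟩ | ⟨rfl, rfl, rfl⟩ | ⟨rfl, rfl, rfl⟩ | ⟨rfl, rfl, rfl⟩ | ⟨rfl, rfl, rfl⟩ | ⟨rfl, rfl, rfl⟩ | ⟨rfl, rfl, rfl⟩ | ⟨rfl, rfl, rfl⟩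
  · exact ⟨fun h => GenuineM.hex_ref_le_40_M (by decide) hl h11 h T, fun h => WRowM.hex_inh_le_40_M (by decide) hl h T⟩  -- k = 1: (10, 11)
  · exact ⟨fun h => GenuineM.hex_ref_le_40_M (by decide) hl h11 h T, fun h => WRowM.hex_inh_le_40_M (by decide) hl h T⟩  -- k = 2: (10, 11)
  · exact ⟨fun h => GenuineM.hex_ref_le_40_M (by decide) hl h11 h T, fun h => WRowM.hex_inh_le_40_M (by decide) hl h T⟩  -- k = 3: (10, 11)
  · exact ⟨fun h => GenuineM.hex_ref_le_40_M (by decide) hl h11 h T, fun h => WRowM.hex_inh_le_40_M (by decide) hl h T⟩  -- k = 4: (10, 11)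
  · exact ⟨fun h => GenuineM.hex_ref_le_40_M (by decide) hl h11 h T, fun h => WRowM.hex_inh_le_40_M (by decide) hl h T⟩  -- k = 5: (10, 11)
  · exact ⟨fun h => GenuineM.hex_ref_le_40_M (by decide) hl h11 h T, fun h => WRowM.hex_inh_le_40_M (by decide) hl h T⟩  -- k = 6: (10, 11)
  · exact ⟨fun h => GenuineM.hex_ref_le_40_M (by decide) hl h11 h T, fun h => WRowM.hex_inh_le_40_M (by decide) hl h T⟩  -- k = 7: (10, 11)
  · exact ⟨fun h => GenuineM.hex_ref_le_40_M (by decide) hl h11 h T, fun h => WRowM.hex_inh_le_40_M (by decide) hl h T⟩  -- k = 8: (71, 73)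
  · exact ⟨fun h => GenuineM.hex_ref_le_40_M (by decide) hl h11 h T, fun h => WRowM.hex_inh_le_40_M (by decide) hl h T⟩  -- k = 9: (337, 347)
  · exact ⟨fun h => GenuineM.hex_ref_le_40_M (by decide) hl h11 h T, fun h => WRowM.hex_inh_le_40_M (by decide) hl h T⟩  -- k = 10: (4721, 4723)
  · exact ⟨fun h => GenuineM.hex_ref_le_40_M (by decide) hl h11 h T, fun h => WRowM.hex_inh_le_40_M (by decide) hl h T⟩  -- k = 11: (811, 821)
  · exact ⟨fun h => GenuineM.hex_ref_le_40_M (by decide) hl h11 h T, fun h => WRowM.hex_inh_le_40_M (by decide) hl h T⟩  -- k = 12: (20063, 20071)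
  · exact ⟨fun h => GenuineM.hex_ref_le_40_M (by decide) hl h11 h T, fun h => WRowM.hex_inh_le_40_M (by decide) hl h T⟩  -- k = 13: (5851, 5857)
  · exact ⟨fun h => GenuineM.hex_ref_le_40_M (by decide) hl h11 h T, fun h => WRowM.hex_inh_le_40_M (by decide) hl h T⟩  -- k = 14: (46933, 46957)
  · exact ⟨fun h => GenuineM.hex_ref_le_40_M (by decide) hl h11 h T, fun h => WRowM.hex_inh_le_40_M (by decide) hl h T⟩  -- k = 15: (617587, 617647)
  · exact ⟨fun h => GenuineM.hex_ref_le_40_M (by decide) hl h11 h T, fun h => WRowM.hex_inh_le_40_M (by decide) hl h T⟩  -- k = 16: (329269, 329281)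
  · exact ⟨fun h => GenuineM.hex_ref_le_40_M (by decide) hl h11 h T, fun h => WRowM.hex_inh_le_40_M (by decide) hl h T⟩  -- k = 17: (288203, 288209)
  · exact ⟨fun h => GenuineM.hex_ref_le_40_M (by decide) hl h11 h T, fun h => WRowM.hex_inh_le_40_M (by decide) hl h T⟩  -- k = 18: (6917593, 6917611)
  · exact ⟨fun h => GenuineM.hex_ref_le_40_M (by decide) hl h11 h T, fun h => WRowM.hex_inh_le_40_M (by decide) hl h T⟩  -- k = 19: (2017637, 2017643)
  · exact ⟨fun h => GenuineM.hex_ref_le_40_M (by decide) hl h11 h T, fun h => WRowM.hex_inh_le_40_M (by decide) hl h T⟩  -- k = 20: (80707019, 80707051)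
  · exact ⟨fun h => GenuineM.hex_ref_le_40_M (by decide) hl h11 h T, fun h => WRowM.hex_inh_le_40_M (by decide) hl h T⟩  -- k = 21: (42371239, 42371257)
  · exact ⟨fun h => GenuineM.hex_ref_le_40_M (by decide) hl h11 h T, fun h => WRowM.hex_inh_le_40_M (by decide) hl h T⟩  -- k = 22: (112989881, 112989913)
  · exact ⟨fun h => GenuineM.hex_ref_le_40_M (by decide) hl h11 h T, fun h => WRowM.hex_inh_le_40_M (by decide) hl h T⟩  -- k = 23: (98866283, 98866289)
  · exact ⟨fun h => GenuineM.hex_ref_le_40_M (by decide) hl h11 h T, fun h => WRowM.hex_inh_le_40_M (by decide) hl h T⟩  -- k = 24: (2372791879, 2372791903)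
  · exact ⟨fun h => GenuineM.hex_ref_le_40_M (by decide) hl h11 h T, fun h => WRowM.hex_inh_le_40_M (by decide) hl h T⟩  -- k = 25: (3460321741, 3460321747)
  · exact ⟨fun h => GenuineM.hex_ref_le_40_M (by decide) hl h11 h T, fun h => WRowM.hex_inh_le_40_M (by decide) hl h T⟩  -- k = 26: (5536514639, 5536514681)
  · exact ⟨fun h => GenuineM.hex_ref_le_40_M (by decide) hl h11 h T, fun h => WRowM.hex_inh_le_40_M (by decide) hl h T⟩  -- k = 27: (14533351453, 14533351507)
  · exact ⟨fun h => GenuineM.hex_ref_le_40_M (by decide) hl h11 h T, fun h => WRowM.hex_inh_le_40_M (by decide) hl h T⟩  -- k = 28: (38755603903, 38755603927)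
  · exact ⟨fun h => GenuineM.hex_ref_le_40_M (by decide) hl h11 h T, fun h => WRowM.hex_inh_le_40_M (by decide) hl h T⟩  -- k = 29: (33911153561, 33911153599)
  · exact ⟨fun h => GenuineM.hex_ref_le_40_M (by decide) hl h11 h T, fun h => WRowM.hex_inh_le_40_M (by decide) hl h T⟩  -- k = 30: (4069338436799, 4069338436831)
  · exact ⟨fun h => GenuineM.hex_ref_le_40_M (by decide) hl h11 h T, fun h => WRowM.hex_inh_le_40_M (by decide) hl h T⟩  -- k = 31: (237378075419, 237378075439)
  · exact ⟨fun h => GenuineM.hex_ref_le_40_M (by decide) hl h11 h T, fun h => WRowM.hex_inh_le_40_M (by decide) hl h T⟩  -- k = 32: (1899024603689, 1899024603703)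
  · exact ⟨fun h => GenuineM.hex_ref_le_40_M (by decide) hl h11 h T, fun h => WRowM.hex_inh_le_40_M (by decide) hl h T⟩  -- k = 33: (4984939585357, 4984939585387)
  · exact ⟨fun h => GenuineM.hex_ref_le_40_M (by decide) hl h11 h T, fun h => WRowM.hex_inh_le_40_M (by decide) hl h T⟩  -- k = 34: (13293172227497, 13293172227557)
  · exact ⟨fun h => GenuineM.hex_ref_le_40_M (by decide) hl h11 h T, fun h => WRowM.hex_inh_le_40_M (by decide) hl h T⟩  -- k = 35: (58157628496679, 58157628496739)
  · exact ⟨fun h => GenuineM.hex_ref_le_40_M (by decide) hl h11 h T, fun h => WRowM.hex_inh_le_40_M (by decide) hl h T⟩  -- k = 36: (279156616784327, 279156616784387)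
  · exact ⟨fun h => GenuineM.hex_ref_le_40_M (by decide) hl h11 h T, fun h => WRowM.hex_inh_le_40_M (by decide) hl h T⟩  -- k = 37: (81420679895431, 81420679895459)
  · exact ⟨fun h => GenuineM.hex_ref_le_40_M (by decide) hl h11 h T, fun h => WRowM.hex_inh_le_40_M (by decide) hl h T⟩  -- k = 38: (651365439163823, 651365439163849)
  · exact ⟨fun h => GenuineM.hex_ref_le_40_M (by decide) hl h11 h T, fun h => WRowM.hex_inh_le_40_M (by decide) hl h T⟩  -- k = 39: (1709834277805873, 1709834277805961)
  · exact ⟨fun h => GenuineM.hex_ref_le_40_M (by decide) hl h11 h T, fun h => WRowM.hex_inh_le_40_M (by decide) hl h T⟩  -- k = 40: (22797790370745883, 22797790370745947)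

end Summit.ABC.IUTFork.Conditional

end
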